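import Summits.QuantumFields.BalabanUV.Beta.D1BFx.DshWordMass
import Summits.QuantumFields.BalabanUV.Beta.BorderedHessianSymmetry

/-!
# `BalabanUV.Beta.D1BFx.DshWordTadpole` — road «BF-x», binder row D1, PART 24-hyb HEAD (OWNER d1-p2 g25 `ChartDefectHead` v1.1; SPEC v1.2 §4; N-g25-1 «mass currency = pricing»):
# **THE `Dsh`-WORD TADPOLE AGAINST ANY PACKED LEG WHOSE `ℋ`-TYPE COLUMNS ARE BOUNDED IS A (5.10)-KERNEL — `Decay510 (z ↦ ½·tadpole G ([diagK (h z),[diagK g, Dsh n]]))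
# (½·S·2·(Ch·Cg·(e^{8nδ}+1)²·(4·(2·(n^{3+1}·((3+1)·n))))·Zl 4 (δ∕2·n))) (δ∕2·n)`: NET `n⁵ × S`** (FILE 2 of 3; FILE 1 = `DshWordMass` (the column masses), FILE 3 = `ChartDefectRowsDshMass`
# (the HEAD's row (dd) at the record's weights; the straight-leg and road-leg counts))

HONEST DEPENDENCY (cell records, verbatim): «continuum YM on T⁴ ⇐ BetaPertH ∧ nine spine estimates (0/9 proved); BetaPertH ⇐ (D1) ∧ (D4) ∧
CAP+tail; G-an2-4 gates asym, D1 and NE2/3/4.»  HONEST FRAMING (cell contract, verbatim): «discharging `BetaPertH` makes Bałaban's UV stability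
UNCONDITIONAL — a real constructive-QFT result; it is NOT the continuum limit and NOT the Clay problem.»  THIS MODULE is [folklore] `ℓ¹` bookkeeping BY NAME over
FILE 1 `DshWordMass` and d1-leaf-04's `GhostWordEnvelope` plumbing; Mathlib's `summable_prod_of_nonneg` ∕ `Equiv.prodComm` turn FILE 1's column masses into ONE absolutely
convergent sum on `ℤ⁴ × ℤ⁴` (the letter shape of FILE 1 §0 `abs_tadpole_le_of_bddOn_mass`).  The LEG letters are DISPLAYED hypotheses on an ARBITRARY packed kernel `G`:
`|G x (n•Y) (inl α) (inr m)| ≤ S` and `|G (n•X) y (inr m) (inl α)| ≤ S` — its `ℋ`-type entries at the coarse points (gan24-leaf-05's «K0-REST-ROW» convention `Bdd G S` made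
BLOCKWISE and restricted to the word's support: the leg's ff block `Γ` and mm block never meet this word); for a sign-symmetric leg (`trK G = sgnK G`: lit-side `BubbleParity.
trK_KInvStep ∕ trK_coDressKBmAt_KInvStep`) ONE column letter `|colH G n μ Y κ u| ≤ S` gives both (`abs_inr_inl_le_of_sgn`).  Nothing about Bałaban's (or an1's) tables is
asserted; no `def`, no `def … : Prop`, nothing cited, 0 sorry.  0∕4 row-D1 binders (hW ∕ hR ∕ D1Tel ∕ D1Rep); (K) NOT closed; (J1) ONE OPEN ROW; NOT D1, NEVER «G-an2-4 closed»,
NOT `BetaPertH`, NOT continuum, NOT Clay.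

ABSOLUTE RULE (cell charter, verbatim): «No internally-minted statement may enter as a cited fact. Every hypothesis is either kernel-proved in
this package or a verbatim quotation of a PUBLISHED theorem with page reference. The manuscript(s) under audit are NOT citable for their own
disputed steps — they are the thing under adjudication; programme-internal (2001/route/tribunal) claims are never citable.»

CONTENT (weights `g`, `h z : Site 4 → Fib 3 → ℝ` with DISPLAYED envelopes `Cg·e^{−δ|· − n•y|₁}`, `Ch·e^{−δ|· − n•y′|₁}`; `W := comp (diagK h) ([diagK g, Dsh n]) − comp ([diagK g, Dsh n]) (diagK h)`,
`E := e^{8nδ}`, `T := 4·(2·(n^{3+1}·((3+1)·n)))`).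
* §2b `word_col_summable`, `fibreMass_word_eq`, `word_inl_inr_prod_mass_le`, **`word_mass_le`** (`Summable` on `ℤ⁴ × ℤ⁴` ∧ `Σ'_{(y,x)} Σ_{f a} |W y x f a| ≤ 2·(Ch·Cg·(E+1)²·T·Zl 4 (δ∕2·n))·e^{−(δ∕2·n)|y′ − y|₁}`).
* §3 **`decay510_half_tadpole_word`** (the (5.10)-kernel above), `abs_inr_inl_le_of_sgn`.
NOT HERE: the record's weights, the straight leg, the road leg (FILE 3).  Unit `b2b-balaban-beta-d1-formalise-leaf-01` (gen 33), road «BF-x»; OFFER O-9 part 2.  Not in print;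
our bookkeeping.  No existing file touched.
-/

noncomputable section

namespace Summit.QuantumFields.BalabanUV.Beta.D1BFx.DshWordTadpole

open Finset
open scoped BigOperators
open Literature.MathematicalPhysics.QuantumFieldTheory
open Literature.MathematicalPhysics.QuantumFieldTheory.LatticeForm (quo)
open Literature.MathematicalPhysics.QuantumFieldTheory.Balaban1983to89
open Literature.MathematicalPhysics.QuantumFieldTheory.Balaban1983to89.Beta
open B12Sec2to5 (l1 l1_nonneg Decay510)
open ExpKernelCalculus (MKer Zl comp tr tadpole)
open OneStepResolventKernel (Fib eq_zsmul_quo_of_proj)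
open OneStepKernelFamily (colH)
open AffineAveraging (Site)
open Summit.QuantumFields.BalabanUV.Beta.BorderedHessian (diagK sgnK sgnK_apply sgnF_inl sgnF_inr)
open Summit.QuantumFields.BalabanUV.Beta.TameKernelCalculus (trK trK_apply)
open Summit.QuantumFields.BalabanUV.Beta.DshAn1 (Dsh)
open Summit.QuantumFields.BalabanUV.Beta.D1BFx.DshWordMass

/-! ## §2b The full fibre mass of the word on `ℤ⁴ × ℤ⁴` (the letter shape of `abs_tadpole_le_of_bddOn_mass`) -/

section FullMass

variable {n : ℕ} [NeZero n]
variable (g h : Site (3 + 1) → Fib 3 → ℝ) {Cg Ch δ : ℝ} {yb yz : Site (3 + 1)}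

/-- [folklore] Every column of the word's field–multiplier block is summable (coarse columns: `word_col_mass_le`; the others vanish). -/
theorem word_col_summable (hCg : 0 ≤ Cg) (hCh : 0 ≤ Ch) (hδ : 0 ≤ δ)
    (hg : ∀ x a, |g x a| ≤ Cg * Real.exp (-δ * l1 (x - (n : ℤ) • yb))) (hh : ∀ x a, |h x a| ≤ Ch * Real.exp (-δ * l1 (x - (n : ℤ) • yz)))
    (x : Site (3 + 1)) :
    Summable fun y : Site (3 + 1) => ∑ α : Fin (3 + 1), ∑ m : Fin (3 + 1),
        |(comp (diagK h) (comp (diagK g) (Dsh (d := 3) n) - comp (Dsh (d := 3) n) (diagK g))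
            - comp (comp (diagK g) (Dsh (d := 3) n) - comp (Dsh (d := 3) n) (diagK g)) (diagK h)) y x (Sum.inl α) (Sum.inr m)| := by
  by_cases hx : Literature.Probability.LatticeModels.Torus.proj n x = 0
  · have ex : x = (n : ℤ) • quo n x := eq_zsmul_quo_of_proj (N := n) hx
    rw [ex]
    exact (word_col_mass_le g h hCg hCh hδ hg hh (quo n x)).1
  · have h0 : (fun y : Site (3 + 1) => ∑ α : Fin (3 + 1), ∑ m : Fin (3 + 1),
        |(comp (diagK h) (comp (diagK g) (Dsh (d := 3) n) - comp (Dsh (d := 3) n) (diagK g))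
            - comp (comp (diagK g) (Dsh (d := 3) n) - comp (Dsh (d := 3) n) (diagK g)) (diagK h)) y x (Sum.inl α) (Sum.inr m)|) = fun _ => 0 := by
      funext y
      simp only [word_inl_inr_eq_zero_of_proj_ne g h hx, abs_zero, Finset.sum_const_zero]
    rw [h0]
    exact summable_zero

omit [NeZero n] in
/-- [folklore] The full fibre mass of the word at a pair of sites splits into the two off-diagonal blocks (the diagonal ones vanish). -/
theorem fibreMass_word_eq (p : Site (3 + 1) × Site (3 + 1)) :
    ∑ f : Fib 3, ∑ a : Fib 3, |(comp (diagK h) (comp (diagK g) (Dsh (d := 3) n) - comp (Dsh (d := 3) n) (diagK g))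
            - comp (comp (diagK g) (Dsh (d := 3) n) - comp (Dsh (d := 3) n) (diagK g)) (diagK h)) p.1 p.2 f a|
      = (∑ α : Fin (3 + 1), ∑ m : Fin (3 + 1), |(comp (diagK h) (comp (diagK g) (Dsh (d := 3) n) - comp (Dsh (d := 3) n) (diagK g))
            - comp (comp (diagK g) (Dsh (d := 3) n) - comp (Dsh (d := 3) n) (diagK g)) (diagK h)) p.1 p.2 (Sum.inl α) (Sum.inr m)|)
        + ∑ α : Fin (3 + 1), ∑ m : Fin (3 + 1), |(comp (diagK h) (comp (diagK g) (Dsh (d := 3) n) - comp (Dsh (d := 3) n) (diagK g))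
            - comp (comp (diagK g) (Dsh (d := 3) n) - comp (Dsh (d := 3) n) (diagK g)) (diagK h)) p.2 p.1 (Sum.inl α) (Sum.inr m)| := by
  rw [Fintype.sum_sum_type]
  congr 1
  · refine Finset.sum_congr rfl fun α _ => ?_
    rw [Fintype.sum_sum_type]
    simp only [word_inl_inl, abs_zero, Finset.sum_const_zero, zero_add]
  · simp only [Fintype.sum_sum_type, word_inr_inr, abs_zero, Finset.sum_const_zero, add_zero, abs_word_inr_inl]
    exact Finset.sum_comm

/-- [folklore] The word's field–multiplier block as a function on `ℤ⁴ × ℤ⁴` is summable with the bound of `word_inl_inr_mass_le` (swap the pair, sum by columns). -/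
theorem word_inl_inr_prod_mass_le (hCg : 0 ≤ Cg) (hCh : 0 ≤ Ch) (hδ : 0 < δ)
    (hg : ∀ x a, |g x a| ≤ Cg * Real.exp (-δ * l1 (x - (n : ℤ) • yb))) (hh : ∀ x a, |h x a| ≤ Ch * Real.exp (-δ * l1 (x - (n : ℤ) • yz))) :
    (Summable fun p : Site (3 + 1) × Site (3 + 1) => ∑ α : Fin (3 + 1), ∑ m : Fin (3 + 1),
        |(comp (diagK h) (comp (diagK g) (Dsh (d := 3) n) - comp (Dsh (d := 3) n) (diagK g))
            - comp (comp (diagK g) (Dsh (d := 3) n) - comp (Dsh (d := 3) n) (diagK g)) (diagK h)) p.1 p.2 (Sum.inl α) (Sum.inr m)|) ∧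
      ∑' p : Site (3 + 1) × Site (3 + 1), ∑ α : Fin (3 + 1), ∑ m : Fin (3 + 1),
          |(comp (diagK h) (comp (diagK g) (Dsh (d := 3) n) - comp (Dsh (d := 3) n) (diagK g))
            - comp (comp (diagK g) (Dsh (d := 3) n) - comp (Dsh (d := 3) n) (diagK g)) (diagK h)) p.1 p.2 (Sum.inl α) (Sum.inr m)|
        ≤ (Ch * Cg * (Real.exp (δ * (((3 : ℝ) + 1) * (2 * n))) + 1) ^ 2 * (4 * (2 * ((n : ℝ) ^ (3 + 1) * (((3 : ℝ) + 1) * n))))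
            * Zl 4 (δ / 2 * n)) * Real.exp (-(δ / 2 * n) * l1 (yz - yb)) := by
  -- the swapped function is summable by columns
  have hG : Summable fun q : Site (3 + 1) × Site (3 + 1) => ∑ α : Fin (3 + 1), ∑ m : Fin (3 + 1),
      |(comp (diagK h) (comp (diagK g) (Dsh (d := 3) n) - comp (Dsh (d := 3) n) (diagK g))
            - comp (comp (diagK g) (Dsh (d := 3) n) - comp (Dsh (d := 3) n) (diagK g)) (diagK h)) q.2 q.1 (Sum.inl α) (Sum.inr m)| := by
    refine (summable_prod_of_nonneg fun q => Finset.sum_nonneg fun α _ => Finset.sum_nonneg fun m _ => abs_nonneg _).2 ⟨fun x => ?_, ?_⟩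
    · exact word_col_summable g h hCg hCh hδ.le hg hh x
    · exact (word_inl_inr_mass_le g h hCg hCh hδ hg hh).1
  have hGs := ((Equiv.prodComm (Site (3 + 1)) (Site (3 + 1))).summable_iff
    (f := fun p : Site (3 + 1) × Site (3 + 1) => ∑ α : Fin (3 + 1), ∑ m : Fin (3 + 1), |(comp (diagK h) (comp (diagK g) (Dsh (d := 3) n) - comp (Dsh (d := 3) n) (diagK g))
            - comp (comp (diagK g) (Dsh (d := 3) n) - comp (Dsh (d := 3) n) (diagK g)) (diagK h)) p.1 p.2 (Sum.inl α) (Sum.inr m)|)).1 hG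
  refine ⟨hGs, ?_⟩
  rw [← (Equiv.prodComm (Site (3 + 1)) (Site (3 + 1))).tsum_eq
    (fun p : Site (3 + 1) × Site (3 + 1) => ∑ α : Fin (3 + 1), ∑ m : Fin (3 + 1), |(comp (diagK h) (comp (diagK g) (Dsh (d := 3) n) - comp (Dsh (d := 3) n) (diagK g))
            - comp (comp (diagK g) (Dsh (d := 3) n) - comp (Dsh (d := 3) n) (diagK g)) (diagK h)) p.1 p.2 (Sum.inl α) (Sum.inr m)|)]
  show ∑' q : Site (3 + 1) × Site (3 + 1), ∑ α : Fin (3 + 1), ∑ m : Fin (3 + 1), |(comp (diagK h) (comp (diagK g) (Dsh (d := 3) n) - comp (Dsh (d := 3) n) (diagK g))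
            - comp (comp (diagK g) (Dsh (d := 3) n) - comp (Dsh (d := 3) n) (diagK g)) (diagK h)) q.2 q.1 (Sum.inl α) (Sum.inr m)| ≤ _
  rw [hG.tsum_prod' (fun x => word_col_summable g h hCg hCh hδ.le hg hh x)]
  exact (word_inl_inr_mass_le g h hCg hCh hδ hg hh).2

/-- [folklore] **THE FULL `ℓ¹` MASS OF THE `Dsh`-WORD** (the letter of `abs_tadpole_le_of_bddOn_mass`): summable on `ℤ⁴ × ℤ⁴`, and
`Σ'_{(y,x)} Σ_{f a} |W y x f a| ≤ 2·((Ch·Cg·(E+1)²·(4·(2·(n^{3+1}·((3+1)·n)))))·Zl 4 (δ∕2·n))·e^{−(δ∕2·n)|yz − yb|₁}`, `E := e^{8nδ}` — the two off-diagonal blocks mirror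
each other (`abs_word_inr_inl`), each is `word_inl_inr_mass_le`. -/
theorem word_mass_le (hCg : 0 ≤ Cg) (hCh : 0 ≤ Ch) (hδ : 0 < δ)
    (hg : ∀ x a, |g x a| ≤ Cg * Real.exp (-δ * l1 (x - (n : ℤ) • yb))) (hh : ∀ x a, |h x a| ≤ Ch * Real.exp (-δ * l1 (x - (n : ℤ) • yz))) :
    (Summable fun p : Site (3 + 1) × Site (3 + 1) => ∑ f : Fib 3, ∑ a : Fib 3,
        |(comp (diagK h) (comp (diagK g) (Dsh (d := 3) n) - comp (Dsh (d := 3) n) (diagK g))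
            - comp (comp (diagK g) (Dsh (d := 3) n) - comp (Dsh (d := 3) n) (diagK g)) (diagK h)) p.1 p.2 f a|) ∧
      ∑' p : Site (3 + 1) × Site (3 + 1), ∑ f : Fib 3, ∑ a : Fib 3,
          |(comp (diagK h) (comp (diagK g) (Dsh (d := 3) n) - comp (Dsh (d := 3) n) (diagK g))
            - comp (comp (diagK g) (Dsh (d := 3) n) - comp (Dsh (d := 3) n) (diagK g)) (diagK h)) p.1 p.2 f a|
        ≤ 2 * (Ch * Cg * (Real.exp (δ * (((3 : ℝ) + 1) * (2 * n))) + 1) ^ 2 * (4 * (2 * ((n : ℝ) ^ (3 + 1) * (((3 : ℝ) + 1) * n))))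
            * Zl 4 (δ / 2 * n)) * Real.exp (-(δ / 2 * n) * l1 (yz - yb)) := by
  obtain ⟨h1s, h1v⟩ := word_inl_inr_prod_mass_le g h (yb := yb) (yz := yz) hCg hCh hδ hg hh
  have h2s := (Equiv.prodComm (Site (3 + 1)) (Site (3 + 1))).summable_iff.2 h1s
  have h2v : ∑' p : Site (3 + 1) × Site (3 + 1), ((fun p : Site (3 + 1) × Site (3 + 1) => ∑ α : Fin (3 + 1), ∑ m : Fin (3 + 1), |(comp (diagK h) (comp (diagK g) (Dsh (d := 3) n) - comp (Dsh (d := 3) n) (diagK g))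
            - comp (comp (diagK g) (Dsh (d := 3) n) - comp (Dsh (d := 3) n) (diagK g)) (diagK h)) p.1 p.2 (Sum.inl α) (Sum.inr m)|) ∘ ⇑(Equiv.prodComm (Site (3 + 1)) (Site (3 + 1)))) p
      = ∑' p : Site (3 + 1) × Site (3 + 1), (fun p : Site (3 + 1) × Site (3 + 1) => ∑ α : Fin (3 + 1), ∑ m : Fin (3 + 1), |(comp (diagK h) (comp (diagK g) (Dsh (d := 3) n) - comp (Dsh (d := 3) n) (diagK g))
            - comp (comp (diagK g) (Dsh (d := 3) n) - comp (Dsh (d := 3) n) (diagK g)) (diagK h)) p.1 p.2 (Sum.inl α) (Sum.inr m)|) p :=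
    (Equiv.prodComm (Site (3 + 1)) (Site (3 + 1))).tsum_eq (fun p : Site (3 + 1) × Site (3 + 1) => ∑ α : Fin (3 + 1), ∑ m : Fin (3 + 1), |(comp (diagK h) (comp (diagK g) (Dsh (d := 3) n) - comp (Dsh (d := 3) n) (diagK g))
            - comp (comp (diagK g) (Dsh (d := 3) n) - comp (Dsh (d := 3) n) (diagK g)) (diagK h)) p.1 p.2 (Sum.inl α) (Sum.inr m)|)
  have hpt : ∀ p : Site (3 + 1) × Site (3 + 1), (∑ f : Fib 3, ∑ a : Fib 3, |(comp (diagK h) (comp (diagK g) (Dsh (d := 3) n) - comp (Dsh (d := 3) n) (diagK g))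
            - comp (comp (diagK g) (Dsh (d := 3) n) - comp (Dsh (d := 3) n) (diagK g)) (diagK h)) p.1 p.2 f a|)
      = (fun p : Site (3 + 1) × Site (3 + 1) => ∑ α : Fin (3 + 1), ∑ m : Fin (3 + 1), |(comp (diagK h) (comp (diagK g) (Dsh (d := 3) n) - comp (Dsh (d := 3) n) (diagK g))
            - comp (comp (diagK g) (Dsh (d := 3) n) - comp (Dsh (d := 3) n) (diagK g)) (diagK h)) p.1 p.2 (Sum.inl α) (Sum.inr m)|) p + ((fun p : Site (3 + 1) × Site (3 + 1) => ∑ α : Fin (3 + 1), ∑ m : Fin (3 + 1), |(comp (diagK h) (comp (diagK g) (Dsh (d := 3) n) - comp (Dsh (d := 3) n) (diagK g))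
            - comp (comp (diagK g) (Dsh (d := 3) n) - comp (Dsh (d := 3) n) (diagK g)) (diagK h)) p.1 p.2 (Sum.inl α) (Sum.inr m)|) ∘ ⇑(Equiv.prodComm (Site (3 + 1)) (Site (3 + 1)))) p := by
    intro p
    rw [fibreMass_word_eq g h p, Function.comp_apply, Equiv.prodComm_apply]
    simp only [Prod.fst_swap, Prod.snd_swap]
  refine ⟨(h1s.add h2s).congr fun p => (hpt p).symm, ?_⟩
  calc (∑' p : Site (3 + 1) × Site (3 + 1), ∑ f : Fib 3, ∑ a : Fib 3, |(comp (diagK h) (comp (diagK g) (Dsh (d := 3) n) - comp (Dsh (d := 3) n) (diagK g))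
            - comp (comp (diagK g) (Dsh (d := 3) n) - comp (Dsh (d := 3) n) (diagK g)) (diagK h)) p.1 p.2 f a|)
      = ∑' p : Site (3 + 1) × Site (3 + 1), ((fun p : Site (3 + 1) × Site (3 + 1) => ∑ α : Fin (3 + 1), ∑ m : Fin (3 + 1), |(comp (diagK h) (comp (diagK g) (Dsh (d := 3) n) - comp (Dsh (d := 3) n) (diagK g))
            - comp (comp (diagK g) (Dsh (d := 3) n) - comp (Dsh (d := 3) n) (diagK g)) (diagK h)) p.1 p.2 (Sum.inl α) (Sum.inr m)|) p + ((fun p : Site (3 + 1) × Site (3 + 1) => ∑ α : Fin (3 + 1), ∑ m : Fin (3 + 1), |(comp (diagK h) (comp (diagK g) (Dsh (d := 3) n) - comp (Dsh (d := 3) n) (diagK g))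
            - comp (comp (diagK g) (Dsh (d := 3) n) - comp (Dsh (d := 3) n) (diagK g)) (diagK h)) p.1 p.2 (Sum.inl α) (Sum.inr m)|) ∘ ⇑(Equiv.prodComm (Site (3 + 1)) (Site (3 + 1)))) p) := tsum_congr hpt
    _ = (∑' p : Site (3 + 1) × Site (3 + 1), (fun p : Site (3 + 1) × Site (3 + 1) => ∑ α : Fin (3 + 1), ∑ m : Fin (3 + 1), |(comp (diagK h) (comp (diagK g) (Dsh (d := 3) n) - comp (Dsh (d := 3) n) (diagK g))
            - comp (comp (diagK g) (Dsh (d := 3) n) - comp (Dsh (d := 3) n) (diagK g)) (diagK h)) p.1 p.2 (Sum.inl α) (Sum.inr m)|) p) + ∑' p : Site (3 + 1) × Site (3 + 1), ((fun p : Site (3 + 1) × Site (3 + 1) => ∑ α : Fin (3 + 1), ∑ m : Fin (3 + 1), |(comp (diagK h) (comp (diagK g) (Dsh (d := 3) n) - comp (Dsh (d := 3) n) (diagK g))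
            - comp (comp (diagK g) (Dsh (d := 3) n) - comp (Dsh (d := 3) n) (diagK g)) (diagK h)) p.1 p.2 (Sum.inl α) (Sum.inr m)|) ∘ ⇑(Equiv.prodComm (Site (3 + 1)) (Site (3 + 1)))) p := h1s.tsum_add h2s
    _ ≤ _ := by rw [h2v]; linarith

end FullMass

/-! ## §3 A `Dsh`-word tadpole against a leg whose `ℋ`-type COLUMNS are bounded: the (5.10)-kernel with its constant -/

section Row

variable {n : ℕ} [NeZero n]

/-- [folklore] **THE `Dsh`-WORD TADPOLE FAMILY AGAINST A LEG WITH BOUNDED `ℋ`-TYPE COLUMNS IS A (5.10)-KERNEL** (MASS currency): for ANY packed leg `G` whose field–multiplier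
columns at the coarse points and multiplier–field rows at the coarse points are bounded, `|G x (n•Y) (inl α) (inr m)| ≤ S`, `|G (n•X) y (inr m) (inl α)| ≤ S` (`0 ≤ S` — ONLY these
entries meet the word; the leg's ff block `Γ` and its mm block never do), weights `g` (envelope `Cg·e^{−δ|· − 0|₁}`) and `h z` (envelope `Ch·e^{−δ|· − n•z|₁}`, every `z`), `0 < δ`:
`Decay510 (z ↦ ½·tadpole G ([diagK (h z), [diagK g, Dsh n]])) (½·(S·(2·((Ch·Cg·(e^{8nδ}+1)²·(4·(2·(n^{3+1}·((3+1)·n)))))·Zl 4 (δ∕2·n))))) (δ∕2·n)`. -/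
theorem decay510_half_tadpole_word {G : MKer (3 + 1) (Fib 3)} {S : ℝ} (hS : 0 ≤ S)
    (hcolR : ∀ (x Y : Site (3 + 1)) (α m : Fin (3 + 1)), |G x ((n : ℤ) • Y) (Sum.inl α) (Sum.inr m)| ≤ S)
    (hcolL : ∀ (X y : Site (3 + 1)) (m α : Fin (3 + 1)), |G ((n : ℤ) • X) y (Sum.inr m) (Sum.inl α)| ≤ S)
    (g : Site (3 + 1) → Fib 3 → ℝ) (h : Site (3 + 1) → Site (3 + 1) → Fib 3 → ℝ) {Cg Ch δ : ℝ} (hCg : 0 ≤ Cg) (hCh : 0 ≤ Ch) (hδ : 0 < δ)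
    (hg : ∀ x a, |g x a| ≤ Cg * Real.exp (-δ * l1 (x - (n : ℤ) • (0 : Site (3 + 1)))))
    (hh : ∀ z x a, |h z x a| ≤ Ch * Real.exp (-δ * l1 (x - (n : ℤ) • z))) :
    Decay510 (fun z : Site (3 + 1) => (1 / 2 : ℝ) * tadpole G
        (comp (diagK (h z)) (comp (diagK g) (Dsh (d := 3) n) - comp (Dsh (d := 3) n) (diagK g))
            - comp (comp (diagK g) (Dsh (d := 3) n) - comp (Dsh (d := 3) n) (diagK g)) (diagK (h z))))
      ((1 / 2 : ℝ) * (S * (2 * (Ch * Cg * (Real.exp (δ * (((3 : ℝ) + 1) * (2 * n))) + 1) ^ 2 * (4 * (2 * ((n : ℝ) ^ (3 + 1) * (((3 : ℝ) + 1) * n))))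
            * Zl 4 (δ / 2 * n)))))
      (δ / 2 * n) := by
  intro z
  have hm := word_mass_le (n := n) g (h z) (yb := 0) (yz := z) hCg hCh hδ hg (hh z)
  rw [sub_zero] at hm
  -- the leg letter on the word's support pattern: a non-zero entry has its multiplier index on the coarse sublattice
  have hL : ∀ x y (a f : Fib 3), (comp (diagK (h z)) (comp (diagK g) (Dsh (d := 3) n) - comp (Dsh (d := 3) n) (diagK g))
            - comp (comp (diagK g) (Dsh (d := 3) n) - comp (Dsh (d := 3) n) (diagK g)) (diagK (h z))) y x f a ≠ 0 → |G x y a f| ≤ S := by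
    intro x y a f hne
    rcases f with α | m <;> rcases a with β | m'
    · exact absurd (word_inl_inl g (h z) y x α β) hne
    · by_cases hx : Literature.Probability.LatticeModels.Torus.proj n x = 0
      · rw [eq_zsmul_quo_of_proj (N := n) hx]; exact hcolL (quo n x) y m' α
      · exact absurd (word_inl_inr_eq_zero_of_proj_ne g (h z) hx y α m') hne
    · by_cases hy : Literature.Probability.LatticeModels.Torus.proj n y = 0
      · rw [eq_zsmul_quo_of_proj (N := n) hy]; exact hcolR x (quo n y) β m
      · refine absurd ?_ hne
        rw [← abs_eq_zero, abs_word_inr_inl, abs_eq_zero]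
        exact word_inl_inr_eq_zero_of_proj_ne g (h z) hy x β m
    · exact absurd (word_inr_inr g (h z) y x m m') hne
  have ht := abs_tadpole_le_of_bddOn_mass hL hm.1
  rw [abs_mul, abs_of_pos (by norm_num : (0 : ℝ) < 1 / 2)]
  calc (1 / 2 : ℝ) * |tadpole G (comp (diagK (h z)) (comp (diagK g) (Dsh (d := 3) n) - comp (Dsh (d := 3) n) (diagK g))
            - comp (comp (diagK g) (Dsh (d := 3) n) - comp (Dsh (d := 3) n) (diagK g)) (diagK (h z)))|
      ≤ (1 / 2 : ℝ) * (S * (2 * (Ch * Cg * (Real.exp (δ * (((3 : ℝ) + 1) * (2 * n))) + 1) ^ 2 * (4 * (2 * ((n : ℝ) ^ (3 + 1) * (((3 : ℝ) + 1) * n))))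
            * Zl 4 (δ / 2 * n)) * Real.exp (-(δ / 2 * n) * l1 z))) :=
        mul_le_mul_of_nonneg_left (ht.trans (mul_le_mul_of_nonneg_left hm.2 hS)) (by norm_num)
    _ = _ := by ring

omit [NeZero n] in
/-- [folklore] **SIGN-SYMMETRIC LEGS**: if `trK G = sgnK G` (the packed resolvents: `BubbleParity.trK_KInvStep`, `trK_coDressKBmAt_KInvStep`), the multiplier–field rows are minus the
transposed field–multiplier columns, so ONE column letter `|colH G n μ Y κ u| ≤ S` gives both hypotheses of `decay510_half_tadpole_word`. -/
theorem abs_inr_inl_le_of_sgn {G : MKer (3 + 1) (Fib 3)} {S : ℝ} (hsym : trK G = sgnK G) (hcol : ∀ (μ : Fin (3 + 1)) (Y : Site (3 + 1)) (κ : Fin (3 + 1)) (u : Site (3 + 1)),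
      |colH G n μ Y κ u| ≤ S) (X y : Site (3 + 1)) (m α : Fin (3 + 1)) :
    |G ((n : ℤ) • X) y (Sum.inr m) (Sum.inl α)| ≤ S := by
  have e : G ((n : ℤ) • X) y (Sum.inr m) (Sum.inl α) = trK G y ((n : ℤ) • X) (Sum.inl α) (Sum.inr m) := rfl
  rw [e, hsym, sgnK_apply, sgnF_inl, sgnF_inr, abs_mul, abs_mul, abs_one, abs_neg, abs_one, one_mul, one_mul]
  exact hcol m X α y

end Row

end Summit.QuantumFields.BalabanUV.Beta.D1BFx.DshWordTadpole

end
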